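import Summits.MatrixMultiplication.MatrixMultiplication.Theorems.OutsiderSandwichNoTightExchange
import HarnessLib

/-!
# The slice-rank floor of the amortised exchange table: `m·4^N + B·2^{N-1} ≤ B·4^N`

Route `OutsiderSandwich` (decomposition cell `decomp-mm`, lens 4 «minimal counterexample /
extremal reduction», gen 28), support for the aside leaf `BlockOneIsMM`
(stmt-MatrixMultiplication-27147).

`OutsiderSandwichNoTightExchange` exhibited ONE kernel vector of every input-leg slice of
`⟨B⟩ ⊠ P^{⊠N}` (`P ≅ C₁` the pair tensor).  Here the kernel is COUNTED: the cancellation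
`y'·(Xy) = y·(Xᵀy')` happens inside each pair `{h, h̄}` of complementary half-strings, so every
input slice `S_ω` of `⟨B⟩ ⊠ P^{⊠(n+1)}` has `B·2^n` linearly independent kernel vectors with
pairwise disjoint supports (`kerVec`, `linearIndependent_kerVec`) — for EVERY weight `ω`, a pair on
which `ω` vanishes contributing a zero column instead.  Rank–nullity and slice transport give the
quantitative floor of the amortised exchange table:

**Theorem** (`amortised_floor`). `⟨B⟩ ⊠ C₁^{⊠(n+1)} ⊵ ⟨m⟩ ⊠ ⟨2,2,2⟩^{⊠(n+1)}` implies
`m·4^{n+1} + B·2^n ≤ B·4^{n+1}`, i.e. `B/m ≥ 1/(1 − 2^{−(N+1)})` at level `N`.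

At level one this is `4m ≤ 3B` (`level_one_floor`): the level-one amortised ratio is at least
`4/3` — so direct-sum amortisation at level one cannot beat the symmetric-core exponent
`log₂(4/3)` — and together with direct sums of the `(3 → 2)` certificate of `OutsiderSandwichYield`
(`amortised_add`) the first row of the table reads `r(1,1) = 2`, `r(1,2) = 3`, `r(1,4) = 6`
(`amortised_one_four`), `r(1,3) ∈ {4,5}`, `r(1,2k) ∈ [⌈8k/3⌉, 3k]`.

## References
* D. Coppersmith, S. Winograd, *Matrix multiplication via arithmetic progressions*,
  J. Symbolic Comput. 9 (1990) 251–280, §7. [CoppersmithWinograd1990]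
* P. Bürgisser, M. Clausen, M. A. Shokrollahi, *Algebraic Complexity Theory*, Springer 1997,
  §14.4 (substitution / flattening rank bounds). [BurgisserClausenShokrollahi1997]
* M. Bläser, *Fast Matrix Multiplication*, Theory of Computing Library, Graduate Surveys 5 (2013),
  §4–5. [Blaser2013]
-/

noncomputable section

open scoped BigOperators Matrix

set_option linter.dupNamespace false
set_option autoImplicit false

namespace Summit.MatrixMultiplication.MatrixMultiplication.Theorems.OutsiderSandwichSliceRank

open Literature.Computability.AlgebraicComplexity
open Summit.MatrixMultiplication.MatrixMultiplication.Theorems.OutsiderSandwichCoupling (coupling₁)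
open Summit.MatrixMultiplication.MatrixMultiplication.Theorems.OutsiderSandwichBlockNormalForm
  (pairTensor)
open Summit.MatrixMultiplication.MatrixMultiplication.Theorems.OutsiderSandwichNoTightExchange
  (slice slice_apply slice_restrict J src tgt src_symm pairTensor_halves idWeight slice_tgt_idWeight
    src_restrictsTo_coupling)

variable {n B : ℕ}

/-! ## 1. Pairs of complementary half-strings -/

/-- The pair label of an index of `⟨B⟩ ⊠ P^{⊠(n+1)}`: its copy, and for each letter `j ≥ 1` whether
its half agrees with the half of letter `0` (invariant under complementing all halves). -/
def key (z : J (n + 1) B) : Fin B × (Fin n → Fin 2) :=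
  (z.1, fun j => if (z.2 0).1 = (z.2 j.succ).1 then 0 else 1)

/-- The sign of an index: the half of its letter `0`. -/
def hsgn (z : J (n + 1) B) : ℂ := if (z.2 0).1 = 0 then 1 else -1

/-- On the support of the source every letter has its input and output halves opposite.
[cite: CoppersmithWinograd1990, §7] -/
theorem src_halves_at {a y z : J (n + 1) B} (h : src (n + 1) B a y z ≠ 0) (j : Fin (n + 1)) :
    (y.2 j).1 ≠ (z.2 j).1 := by
  refine pairTensor_halves (a := a.2 j) fun h0 => h ?_
  simp only [kroneckerTensor_apply, kroneckerPow_apply]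
  rw [Finset.prod_eq_zero (Finset.mem_univ j) h0, mul_zero]

/-- On the support of the source the copies agree. [folklore] -/
theorem src_copy {a y z : J (n + 1) B} (h : src (n + 1) B a y z ≠ 0) : y.1 = z.1 := by
  by_contra hne
  refine h ?_
  simp only [kroneckerTensor_apply, unitTensor_apply]
  rw [if_neg (fun hh => hne hh.2), zero_mul]

/-- On the support of the source the pair labels agree (complementary half-strings lie in the same
pair). [cite: CoppersmithWinograd1990, §7] -/
theorem key_eq_of_src {a y z : J (n + 1) B} (h : src (n + 1) B a y z ≠ 0) : key y = key z := by
  refine Prod.ext (src_copy h) (funext fun j => ?_)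
  have h0 := src_halves_at h 0
  have hj := src_halves_at h j.succ
  simp only [key]
  generalize (y.2 0).1 = p at h0 ⊢
  generalize (z.2 0).1 = q at h0 ⊢
  generalize (y.2 j.succ).1 = p' at hj ⊢
  generalize (z.2 j.succ).1 = q' at hj ⊢
  fin_cases p <;> fin_cases q <;> fin_cases p' <;> fin_cases q' <;> simp_all

/-- On the support of the source the signs are opposite. [cite: CoppersmithWinograd1990, §7] -/
theorem hsgn_add_of_src {a y z : J (n + 1) B} (h : src (n + 1) B a y z ≠ 0) :
    hsgn z + hsgn y = 0 := by
  have h0 := src_halves_at h 0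
  unfold hsgn
  generalize (y.2 0).1 = p at h0 ⊢
  generalize (z.2 0).1 = q at h0 ⊢
  fin_cases p <;> fin_cases q <;> simp_all

/-- `hsgn z ≠ 0`. [folklore] -/
theorem hsgn_ne_zero (z : J (n + 1) B) : hsgn z ≠ 0 := by
  unfold hsgn; split_ifs <;> norm_num

/-- The representative of a pair: copy `i`, half-string `0·g`, all indices `0`. -/
def rep (p : Fin B × (Fin n → Fin 2)) : J (n + 1) B :=
  (p.1, fun j => ((Fin.cons (0 : Fin 2) p.2 : Fin (n + 1) → Fin 2) j, (0 : Fin 2)))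

/-- The representative lies in its pair. [folklore] -/
theorem key_rep (p : Fin B × (Fin n → Fin 2)) : key (rep p) = p := by
  refine Prod.ext rfl (funext fun j => ?_)
  simp only [key, rep, Fin.cons_zero, Fin.cons_succ]
  have : ∀ x : Fin 2, (if (0 : Fin 2) = x then (0 : Fin 2) else 1) = x := by decide
  exact this _

/-! ## 2. The kernel vectors -/

/-- The signed weight restricted to a pair. -/
def pairVec (ω : J (n + 1) B → ℂ) (p : Fin B × (Fin n → Fin 2)) : J (n + 1) B → ℂ :=
  fun z => if key z = p then hsgn z * ω z else 0

open Classical in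
/-- The kernel vector attached to a pair: the signed weight on the pair if `ω` does not vanish
there, else the coordinate vector of the pair's representative. -/
def kerVec (ω : J (n + 1) B → ℂ) (p : Fin B × (Fin n → Fin 2)) : J (n + 1) B → ℂ :=
  if ∃ z, key z = p ∧ ω z ≠ 0 then pairVec ω p else fun z => if z = rep p then 1 else 0

/-- A kernel vector vanishes outside its pair. [folklore] -/
theorem kerVec_apply_of_key_ne (ω : J (n + 1) B → ℂ) {p : Fin B × (Fin n → Fin 2)}
    {z : J (n + 1) B} (hz : key z ≠ p) : kerVec ω p z = 0 := by
  unfold kerVec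
  split_ifs with h1
  · show (if key z = p then hsgn z * ω z else 0) = 0
    rw [if_neg hz]
  · show (if z = rep p then (1 : ℂ) else 0) = 0
    rw [if_neg]
    rintro rfl
    exact hz (key_rep p)

/-- A kernel vector is non-zero somewhere on its pair. [folklore] -/
theorem exists_kerVec_ne_zero (ω : J (n + 1) B → ℂ) (p : Fin B × (Fin n → Fin 2)) :
    ∃ z, key z = p ∧ kerVec ω p z ≠ 0 := by
  unfold kerVec
  split_ifs with h
  · obtain ⟨z, hz, hω⟩ := h
    refine ⟨z, hz, ?_⟩
    simp only [pairVec, if_pos hz]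
    exact mul_ne_zero (hsgn_ne_zero z) hω
  · exact ⟨rep p, key_rep p, by simp⟩

/-- **The signed pair weight is a kernel vector** of the input slice `S_ω` (the cancellation
`y'·(Xy) = y·(Xᵀy')` inside one pair of complementary half-strings).
[cite: CoppersmithWinograd1990, §7] -/
theorem slice_mulVec_pairVec (ω : J (n + 1) B → ℂ) (p : Fin B × (Fin n → Fin 2)) :
    (slice (src (n + 1) B) ω).mulVec (pairVec ω p) = 0 := by
  funext a
  simp only [Matrix.mulVec, dotProduct, slice_apply, Pi.zero_apply, Finset.sum_mul]
  have hT : ∑ z, ∑ y, ω y * src (n + 1) B a y z * pairVec ω p z =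
      ∑ z, ∑ y, ω z * src (n + 1) B a y z * pairVec ω p y := by
    rw [Finset.sum_comm]
    refine Finset.sum_congr rfl fun u _ => Finset.sum_congr rfl fun v _ => ?_
    rw [src_symm (n + 1) B a u v]
  have hvan : ∀ y z, ω y * src (n + 1) B a y z * pairVec ω p z +
      ω z * src (n + 1) B a y z * pairVec ω p y = 0 := by
    intro y z
    by_cases hs : src (n + 1) B a y z = 0
    · rw [hs]; ring
    · have hk := key_eq_of_src hs
      have hsum := hsgn_add_of_src hs
      unfold pairVec
      by_cases hp : key z = p
      · rw [if_pos hp, if_pos (hk.trans hp)]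
        calc ω y * src (n + 1) B a y z * (hsgn z * ω z) + ω z * src (n + 1) B a y z * (hsgn y * ω y)
            = ω y * src (n + 1) B a y z * ω z * (hsgn z + hsgn y) := by ring
          _ = 0 := by rw [hsum, mul_zero]
      · rw [if_neg hp, if_neg (fun h => hp (hk.symm.trans h)), mul_zero, mul_zero, add_zero]
  have h2 : ∑ z, ∑ y, ω y * src (n + 1) B a y z * pairVec ω p z +
      ∑ z, ∑ y, ω z * src (n + 1) B a y z * pairVec ω p y = 0 := by
    rw [← Finset.sum_add_distrib]
    refine Finset.sum_eq_zero fun z _ => ?_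
    rw [← Finset.sum_add_distrib]
    exact Finset.sum_eq_zero fun y _ => hvan y z
  rw [← hT, ← two_mul] at h2
  exact (mul_eq_zero.mp h2).resolve_left two_ne_zero

/-- **Every `kerVec` is a kernel vector** of the input slice. [cite: CoppersmithWinograd1990, §7] -/
theorem slice_mulVec_kerVec (ω : J (n + 1) B → ℂ) (p : Fin B × (Fin n → Fin 2)) :
    (slice (src (n + 1) B) ω).mulVec (kerVec ω p) = 0 := by
  unfold kerVec
  split_ifs with h
  · exact slice_mulVec_pairVec ω p
  · -- `ω` vanishes on the pair: the column of the representative is zero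
    push Not at h
    funext a
    simp only [Matrix.mulVec, dotProduct, slice_apply, Pi.zero_apply, mul_ite, mul_one, mul_zero,
      Finset.sum_ite_eq', Finset.mem_univ, if_true]
    refine Finset.sum_eq_zero fun y _ => ?_
    by_cases hs : src (n + 1) B a y (rep p) = 0
    · rw [hs, mul_zero]
    · rw [h y ((key_eq_of_src hs).trans (key_rep p)), zero_mul]

/-- **The kernel vectors are linearly independent** (disjoint supports, each non-zero).
[folklore] -/
theorem linearIndependent_kerVec (ω : J (n + 1) B → ℂ) : LinearIndependent ℂ (kerVec ω) := by
  rw [Fintype.linearIndependent_iff]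
  intro g hg p
  obtain ⟨z, hz, hne⟩ := exists_kerVec_ne_zero ω p
  have hpt := congrFun hg z
  simp only [Finset.sum_apply, Pi.smul_apply, smul_eq_mul, Pi.zero_apply] at hpt
  rw [Finset.sum_eq_single p] at hpt
  · exact (mul_eq_zero.mp hpt).resolve_right hne
  · intro q _ hq
    rw [kerVec_apply_of_key_ne ω (fun h => hq (hz.symm.trans h).symm), mul_zero]
  · exact fun h => absurd (Finset.mem_univ p) h

/-! ## 3. The rank bound and the floor -/

/-- **Slice-rank bound**: every input slice of `⟨B⟩ ⊠ P^{⊠(n+1)}` has rank at most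
`B·4^{n+1} − B·2^n`. [cite: BurgisserClausenShokrollahi1997, §14.4] -/
theorem rank_slice_add_le (ω : J (n + 1) B → ℂ) :
    (slice (src (n + 1) B) ω).rank + B * 2 ^ n ≤ B * 4 ^ (n + 1) := by
  set S := slice (src (n + 1) B) ω with hS
  -- the kernel vectors inside `ker S`
  have hmem : ∀ p, kerVec ω p ∈ LinearMap.ker S.mulVecLin := fun p => by
    rw [LinearMap.mem_ker, Matrix.mulVecLin_apply]
    exact slice_mulVec_kerVec ω p
  let u : Fin B × (Fin n → Fin 2) → LinearMap.ker S.mulVecLin := fun p => ⟨kerVec ω p, hmem p⟩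
  have hu : LinearIndependent ℂ u :=
    LinearIndependent.of_comp (LinearMap.ker S.mulVecLin).subtype (linearIndependent_kerVec ω)
  have hcard := hu.fintype_card_le_finrank
  simp only [Fintype.card_prod, Fintype.card_fin, Fintype.card_pi, Finset.prod_const,
    Finset.card_univ] at hcard
  have hrn := LinearMap.finrank_range_add_finrank_ker S.mulVecLin
  rw [Module.finrank_fintype_fun_eq_card] at hrn
  have hJ : Fintype.card (J (n + 1) B) = B * 4 ^ (n + 1) := by
    simp only [Fintype.card_prod, Fintype.card_fin, Fintype.card_pi, Finset.prod_const,
      Finset.card_univ]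
  have hrank : S.rank = Module.finrank ℂ (LinearMap.range S.mulVecLin) := rfl
  omega

/-- **The floor of the amortised exchange table**: `⟨B⟩ ⊠ C₁^{⊠(n+1)} ⊵ ⟨m⟩ ⊠ ⟨2,2,2⟩^{⊠(n+1)}`
forces `m·4^{n+1} + B·2^n ≤ B·4^{n+1}`. [cite: BurgisserClausenShokrollahi1997, §14.4] -/
theorem amortised_floor {m : ℕ}
    (h : TensorRestrictsTo (kroneckerTensor (unitTensor ℂ B) (kroneckerPow coupling₁ (n + 1)))
      (kroneckerTensor (unitTensor ℂ m) (kroneckerPow (matMulTensor ℂ 2 2 2) (n + 1)))) :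
    m * 4 ^ (n + 1) + B * 2 ^ n ≤ B * 4 ^ (n + 1) := by
  obtain ⟨A, B', C, hABC⟩ := (src_restrictsTo_coupling (n + 1) B).trans h
  have key := slice_restrict A B' C hABC (idWeight (n + 1) m)
  rw [slice_tgt_idWeight] at key
  have h2 := rank_slice_add_le (B := B) (fun b => ∑ b', idWeight (n + 1) m b' * B' b' b)
  have h1 : (1 : Matrix (J (n + 1) m) (J (n + 1) m) ℂ).rank ≤
      (slice (src (n + 1) B) (fun b => ∑ b', idWeight (n + 1) m b' * B' b' b)).rank := by
    rw [key]
    exact (Matrix.rank_mul_le_left _ _).trans (Matrix.rank_mul_le_right _ _)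
  rw [Matrix.rank_one] at h1
  have hJ : Fintype.card (J (n + 1) m) = m * 4 ^ (n + 1) := by
    simp only [Fintype.card_prod, Fintype.card_fin, Fintype.card_pi, Finset.prod_const,
      Finset.card_univ]
  omega

/-- **Level one: `4m ≤ 3B`** — the level-one amortised ratio is at least `4/3`.
[cite: CoppersmithWinograd1990, §7] -/
theorem level_one_floor {m : ℕ}
    (h : TensorRestrictsTo (kroneckerTensor (unitTensor ℂ B) (kroneckerPow coupling₁ 1))
      (kroneckerTensor (unitTensor ℂ m) (kroneckerPow (matMulTensor ℂ 2 2 2) 1))) :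
    4 * m ≤ 3 * B := by
  have := amortised_floor (n := 0) h
  omega

/-! ## 4. Direct sums: the first row of the table -/

/-- Amortised certificates ADD at a fixed level: `(N, B, m)` and `(N, B', m')` give
`(N, B + B', m + m')`. [cite: BurgisserClausenShokrollahi1997, (14.21)] -/
theorem amortised_add {N B₁ B₂ m₁ m₂ : ℕ}
    (h : TensorRestrictsTo (kroneckerTensor (unitTensor ℂ B₁) (kroneckerPow coupling₁ N))
      (kroneckerTensor (unitTensor ℂ m₁) (kroneckerPow (matMulTensor ℂ 2 2 2) N)))
    (h' : TensorRestrictsTo (kroneckerTensor (unitTensor ℂ B₂) (kroneckerPow coupling₁ N))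
      (kroneckerTensor (unitTensor ℂ m₂) (kroneckerPow (matMulTensor ℂ 2 2 2) N))) :
    TensorRestrictsTo (kroneckerTensor (unitTensor ℂ (B₁ + B₂)) (kroneckerPow coupling₁ N))
      (kroneckerTensor (unitTensor ℂ (m₁ + m₂)) (kroneckerPow (matMulTensor ℂ 2 2 2) N)) := by
  rw [OutsiderSandwichAmortised.amortised_iff_le] at h h' ⊢
  have := TensorClass.add_le_add h h'
  push_cast
  rw [add_mul, add_mul]
  exact this

/-- **`r(1, 4) = 6`**: five copies of `C₁` do not give four independent `2 × 2` products
(`4·4 > 3·5`), six do (`2 × (⟨3⟩ ⊠ C₁ ⊵ ⟨2⟩ ⊠ ⟨2,2,2⟩)`). [cite: CoppersmithWinograd1990, §7] -/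
theorem amortised_one_four :
    ¬ TensorRestrictsTo (kroneckerTensor (unitTensor ℂ 5) (kroneckerPow coupling₁ 1))
        (kroneckerTensor (unitTensor ℂ 4) (kroneckerPow (matMulTensor ℂ 2 2 2) 1)) ∧
      TensorRestrictsTo (kroneckerTensor (unitTensor ℂ 6) (kroneckerPow coupling₁ 1))
        (kroneckerTensor (unitTensor ℂ 4) (kroneckerPow (matMulTensor ℂ 2 2 2) 1)) := by
  refine ⟨fun h => absurd (level_one_floor h) (by norm_num), ?_⟩
  have h3 := OutsiderSandwichYield.unitThree_coupling₁_restrictsTo_unitTwo_matMul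
  exact amortised_add h3 h3

/-- **`r(1, 3) ≥ 4`** and **`r(1, 3) ≤ 5`**: the first undecided entry of the table
(`⟨4⟩ ⊠ C₁ ⊵ ⟨3⟩ ⊠ ⟨2,2,2⟩`?). [cite: CoppersmithWinograd1990, §7] -/
theorem amortised_one_three :
    ¬ TensorRestrictsTo (kroneckerTensor (unitTensor ℂ 3) (kroneckerPow coupling₁ 1))
        (kroneckerTensor (unitTensor ℂ 3) (kroneckerPow (matMulTensor ℂ 2 2 2) 1)) ∧
      TensorRestrictsTo (kroneckerTensor (unitTensor ℂ 5) (kroneckerPow coupling₁ 1))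
        (kroneckerTensor (unitTensor ℂ 3) (kroneckerPow (matMulTensor ℂ 2 2 2) 1)) := by
  refine ⟨fun h => absurd (level_one_floor h) (by norm_num), ?_⟩
  have h3 := OutsiderSandwichYield.unitThree_coupling₁_restrictsTo_unitTwo_matMul
  have h2 : TensorRestrictsTo (kroneckerTensor (unitTensor ℂ 2) (kroneckerPow coupling₁ 1))
      (kroneckerTensor (unitTensor ℂ 1) (kroneckerPow (matMulTensor ℂ 2 2 2) 1)) := by
    rw [OutsiderSandwichAmortised.restrictsTo_unitOne_iff_helped]
    exact OutsiderSandwichExchangeRate.helped_one_two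
  exact amortised_add h3 h2

end Summit.MatrixMultiplication.MatrixMultiplication.Theorems.OutsiderSandwichSliceRank
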